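import Summits.SmoothPoincare4.SmoothPoincare4.Theorems.EntropyRungNoncompactShrinkerGapHeatMaxPrinciple
import HarnessLib

/-!
# Gradient decay `|∇ρ(s)|² ≤ e^{-2Ks} sup|∇ρ₀|²` along the weighted heat flow on a complete weighted
# manifold (crux `EntropyRung.NoncompactShrinkerGap`, stmt-SmoothPoincare4-10868,
# line `collapsed-ends-usc`, skeleton v13)

Registered helper `helper_gradientDecay`. Setting as in
`EntropyRungNoncompactShrinkerGapHeatMaxPrinciple.lean` (`M` modelled on `ℝⁿ`, `g` Riemannian,
`V` smooth, `L = Δ_g − g⁻¹(dV, d·)`, cut-offs `η_k` with `|Lη_k| ≤ C`), plus the Bakry–Émery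
condition `Ric + Hess V ≥ K g`. **Theorem.** A solution `ρ` of `∂ₛρ = Lρ` on `[0, T]`, smooth on
`M × O` (`O ⊇ [0,T]` open), with `|∇ρ|² e^{-V} ∈ L¹(M × (0,T))` and `|∇ρ(0)|² ≤ G₀` satisfies
`|∇ρ(s)|² ≤ e^{-2Ks} G₀` on `[0, T]`.

Proof: `z = e^{2Ks}|∇ρ|² − G₀` is smooth on `M × O` (`contMDiffOn_gradSq_family`), a subsolution
(`∂ₛ|∇ρ|² = 2 g⁻¹(dρ, d(Lρ))` — `deriv_gradSq_of_heatFlow_isOpen`, the chart computation of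
`derivWithin_gradSq_of_heatFlow` of `WeightedHeatFlowAPriori.lean` for an open time set — and
`2 g⁻¹(dρ, d(Lρ)) ≤ L|∇ρ|² − 2K|∇ρ|²` by `weightedBochner_pointwise_ge`, while
`L(e^{2Ks}|∇ρ|² − G₀) = e^{2Ks} L|∇ρ|²`), `z(0) ≤ 0`, and `z₊ e^{-V} ≤ e^{2|K|T}|∇ρ|² e^{-V}` is
integrable on the strip; hence `z ≤ 0` by `helper_weightedMaxPrinciple`. (Closed case:
`heatFlow_gradSq_le`; Carrillo–Ni 2009, §3, the `C(K, ∞)` computation, p. 8.)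
-/

noncomputable section

set_option linter.dupNamespace false

open scoped Manifold ContDiff ENNReal NNReal Topology
open MeasureTheory Set Filter
open Literature.Geometry.Lorentzian Literature.Geometry.Riemannian

namespace Summit.SmoothPoincare4.SmoothPoincare4.Theorems.NoncompactShrinkerGapHeat

/-! ### Gradient decay along the weighted heat flow on a complete manifold -/

section GradientDecay

variable {n : ℕ} {M : Type*} [TopologicalSpace M] [T2Space M] [SecondCountableTopology M]
  [ChartedSpace (EuclideanSpace ℝ (Fin n)) M] [IsManifold (𝓡 n) ∞ M] [T3Space M]
  [MeasurableSpace M] [BorelSpace M]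
  {g : PseudoRiemannianMetric (𝓡 n) ∞ (EuclideanSpace ℝ (Fin n)) (TangentSpace (𝓡 n) : M → Type _)}
  [g.HasLeviCivita]

omit [T2Space M] [SecondCountableTopology M] [T3Space M] [MeasurableSpace M] [BorelSpace M] in
/-- **`∂ₛ|∇u|² = 2 g⁻¹(du, d(Lu))` along the weighted heat flow, open time set.** If `u` is smooth
on `M × O` (`O` open) and `∂ₛu(t, ·) = Lu(t, ·)` on `M` at a time `t ∈ O`, then
`∂ₛ|∇u|²(t, x) = 2 g⁻¹(du(t), d(Lu(t)))(x)` — the chart computation of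
`derivWithin_gradSq_of_heatFlow` (`WeightedHeatFlowAPriori.lean`, time set `[0, ∞)`) with the time
set `O` (`MetricCoord.IsMetricOn.hasDerivWithinAt_gradSqAt_static`). [folklore] -/
theorem deriv_gradSq_of_heatFlow_isOpen {V : M → ℝ} (hV : ContMDiff (𝓡 n) 𝓘(ℝ, ℝ) ∞ V)
    {u : ℝ → M → ℝ} {O : Set ℝ} (hO : IsOpen O)
    (hu : ContMDiffOn ((𝓡 n).prod 𝓘(ℝ, ℝ)) 𝓘(ℝ, ℝ) ∞ (fun p : M × ℝ ↦ u p.2 p.1) (univ ×ˢ O))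
    {t : ℝ} (ht : t ∈ O)
    (heq : ∀ x, deriv (fun s ↦ u s x) t = g.dalembertian (u t) x -
      g.innerDual x (mvfderiv (𝓡 n) V x).toLinearMap (mvfderiv (𝓡 n) (u t) x).toLinearMap)
    (x : M) :
    deriv (fun s ↦ g.gradSq (u s) x) t =
      2 * g.innerDual x (mvfderiv (𝓡 n) (u t) x).toLinearMap
        (mvfderiv (𝓡 n) (fun y ↦ g.dalembertian (u t) y -
          g.innerDual y (mvfderiv (𝓡 n) V y).toLinearMap
            (mvfderiv (𝓡 n) (u t) y).toLinearMap) x).toLinearMap := by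
  have hS : UniqueDiffOn ℝ O := hO.uniqueDiffOn
  have hS' : O ⊆ closure (interior O) := by rw [hO.interior_eq]; exact subset_closure
  -- the chart at `x`
  set G := chartRep (𝓡 n) (fun _ ↦ g) x 0 with hGdef
  have hGm : MetricCoord.IsMetricOn G (extChartAt (𝓡 n) x).target :=
    OpensChart.isMetricOn_repr (val_chartPullback_eq_chartRep (fun _ : ℝ ↦ g) x 0)
  set Fh : ℝ → EuclideanSpace ℝ (Fin n) → ℝ := fun s z ↦ u s ((extChartAt (𝓡 n) x).symm z)
    with hFhdef
  have hu0 : extChartAt (𝓡 n) x x ∈ (extChartAt (𝓡 n) x).target := mem_extChartAt_target x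
  set u₀ : chartTarget (𝓡 n) x := ⟨extChartAt (𝓡 n) x x, hu0⟩ with hu₀def
  have hΦu₀ : chartInv (𝓡 n) x u₀ = x := extChartAt_to_inv x
  have hslice : ∀ s ∈ O, ContMDiff (𝓡 n) 𝓘(ℝ, ℝ) ∞ (u s) := fun s hs ↦
    contMDiff_slice_of_contMDiffOn hu hs
  have hFh : ContDiffOn ℝ ∞ (fun p : EuclideanSpace ℝ (Fin n) × ℝ ↦ Fh p.2 p.1)
      ((extChartAt (𝓡 n) x).target ×ˢ O) :=
    contDiffOn_family_comp_extChartAt_symm hu x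
  have hut : ContMDiff (𝓡 n) 𝓘(ℝ, ℝ) ∞ (u t) := hslice t ht
  have hud : ∀ y, MDifferentiableAt (𝓡 n) 𝓘(ℝ, ℝ) (u t) y := fun y ↦ hut.mdifferentiableAt (by simp)
  have hLs : ContMDiff (𝓡 n) 𝓘(ℝ, ℝ) ∞ (fun y ↦ g.dalembertian (u t) y -
      g.innerDual y (mvfderiv (𝓡 n) V y).toLinearMap (mvfderiv (𝓡 n) (u t) y).toLinearMap) :=
    (contMDiff_dalembertian g hut).sub (contMDiff_innerDual g hV hut)
  have hLd : MDifferentiableAt (𝓡 n) 𝓘(ℝ, ℝ) (fun y ↦ g.dalembertian (u t) y -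
      g.innerDual y (mvfderiv (𝓡 n) V y).toLinearMap (mvfderiv (𝓡 n) (u t) y).toLinearMap)
      (chartInv (𝓡 n) x u₀) :=
    hLs.mdifferentiableAt (by simp)
  -- (a) `|∇u_s|²(x)` read in the chart, for `s ∈ O`
  have hgrad : ∀ s ∈ O, g.gradSq (u s) x =
      MetricCoord.gradSqAt G (Fh s) (extChartAt (𝓡 n) x x) := by
    intro s hs
    have h := gradSq_chartInv_eq g x u₀ (F := u s) ((hslice s hs).mdifferentiableAt (by simp))
    rw [hΦu₀] at h
    exact h
  have hderiv : derivWithin (fun s ↦ g.gradSq (u s) x) O t =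
      derivWithin (fun s ↦ MetricCoord.gradSqAt G (Fh s) (extChartAt (𝓡 n) x x)) O t :=
    derivWithin_congr (fun s hs ↦ hgrad s hs) (hgrad t ht)
  -- (b) the coordinate time derivative
  have hcoord := (hGm.hasDerivWithinAt_gradSqAt_static hS hS' hFh hu0 ht).derivWithin (hS t ht)
  -- (c) `∂ₜû = (Lu) ∘ φ⁻¹` near `φ x`
  have hrep : MetricCoord.tDerivFun Fh O t =ᶠ[𝓝 (extChartAt (𝓡 n) x x)]
      ((fun y ↦ g.dalembertian (u t) y -
        g.innerDual y (mvfderiv (𝓡 n) V y).toLinearMap (mvfderiv (𝓡 n) (u t) y).toLinearMap) ∘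
        (extChartAt (𝓡 n) x).symm) := by
    filter_upwards [(isOpen_extChartAt_target x).mem_nhds hu0] with z hz
    simp only [MetricCoord.tDerivFun, Function.comp_apply]
    rw [derivWithin_of_isOpen hO ht]
    exact heq _
  -- (d) the bridge for `g⁻¹(du, d(Lu))`
  have hI : g.innerDual x (mvfderiv (𝓡 n) (u t) x).toLinearMap
      (mvfderiv (𝓡 n) (fun y ↦ g.dalembertian (u t) y -
        g.innerDual y (mvfderiv (𝓡 n) V y).toLinearMap
          (mvfderiv (𝓡 n) (u t) y).toLinearMap) x).toLinearMap =
      fderiv ℝ (MetricCoord.tDerivFun Fh O t) (extChartAt (𝓡 n) x x)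
        (MetricCoord.sharpAt G (extChartAt (𝓡 n) x x)
          (fderiv ℝ (Fh t) (extChartAt (𝓡 n) x x))) := by
    have h := innerDual_chartInv_eq g x u₀ (hud _) hLd
    rw [hΦu₀] at h
    rw [h, MetricCoord.apply_sharpAt_comm (hGm.isInvertible _ hu0) (hGm.symm _ hu0),
      hrep.fderiv_eq]
    rfl
  rw [← derivWithin_of_isOpen hO ht, hderiv, hcoord, hI]

end GradientDecay

/-- **Gradient decay `|∇ρ(s)|² ≤ e^{-2Ks} sup|∇ρ₀|²` along the weighted heat flow on a complete
weighted manifold with `Ric + Hess V ≥ K g`** (registered helper `helper_gradientDecay` of line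
`collapsed-ends-usc`): `z = e^{2Ks}|∇ρ|² − G₀` is a subsolution (`∂ₛ|∇ρ|² = 2g⁻¹(dρ, d(Lρ))
≤ L|∇ρ|² − 2K|∇ρ|²` by `weightedBochner_pointwise_ge`, and `L(e^{2Ks}|∇ρ|² − G₀) = e^{2Ks}L|∇ρ|²`)
with `z(0) ≤ 0` and `z₊ e^{-V} ≤ e^{2|K|T}|∇ρ|² e^{-V} ∈ L¹` of the strip, so `z ≤ 0` by the weak
maximum principle `helper_weightedMaxPrinciple`. The closed case is `heatFlow_gradSq_le`
(`WeightedHeatFlowAPriori.lean`). [cite: CarrilloNi2009, §3 (C(K,∞), p. 8)] -/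
theorem helper_gradientDecay : ∀ (n : ℕ) (M : Type*) [TopologicalSpace M] [T2Space M] [SecondCountableTopology M] [ChartedSpace (EuclideanSpace ℝ (Fin n)) M] [IsManifold (𝓡 n) ∞ M] [T3Space M] [MeasurableSpace M] [BorelSpace M] (g : PseudoRiemannianMetric (𝓡 n) ∞ (EuclideanSpace ℝ (Fin n)) (TangentSpace (𝓡 n) : M → Type _)) [g.HasLeviCivita] (V : M → ℝ) (K : ℝ), g.IsRiemannian → ContMDiff (𝓡 n) 𝓘(ℝ, ℝ) ∞ V → (∀ (x : M) (X : TangentSpace (𝓡 n) x), K * g.val x X X ≤ g.ricci x X X + g.hessian V x X X) → ∀ (η : ℕ → M → ℝ) (C : ℝ), (∀ k, ContMDiff (𝓡 n) 𝓘(ℝ, ℝ) ∞ (η k)) → (∀ k, HasCompactSupport (η k)) → (∀ k x, 0 ≤ η k x ∧ η k x ≤ 1) → (∀ k x, η k x ≤ η (k + 1) x) → (∀ x, ∀ᶠ k in atTop, ∀ᶠ y in 𝓝 x, η k y = 1) → (∀ k x, |g.dalembertian (η k) x - g.innerDual x (mvfderiv (𝓡 n) V x).toLinearMap (mvfderiv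 (𝓡 n) (η k) x).toLinearMap| ≤ C) → ∀ (T : ℝ) (O : Set ℝ) (ρ : ℝ → M → ℝ), 0 < T → IsOpen O → Icc 0 T ⊆ O → ContMDiffOn ((𝓡 n).prod 𝓘(ℝ, ℝ)) 𝓘(ℝ, ℝ) ∞ (fun p : M × ℝ ↦ ρ p.2 p.1) (univ ×ˢ O) → (∀ s ∈ Icc 0 T, ∀ x, deriv (fun r ↦ ρ r x) s = g.dalembertian (ρ s) x - g.innerDual x (mvfderiv (𝓡 n) V x).toLinearMap (mvfderiv (𝓡 n) (ρ s) x).toLinearMap) → Integrable (fun p : M × ℝ ↦ g.gradSq (ρ p.2) p.1 * Real.exp (-V p.1)) ((g.riemVolume.prod (volume : Measure ℝ)).restrict (univ ×ˢ Ioo 0 T)) → ∀ (G₀ : ℝ), (∀ x, g.gradSq (ρ 0) x ≤ G₀) → ∀ s ∈ Icc 0 T, ∀ x, g.gradSq (ρ s) x ≤ Real.exp (-2 * K * s) * G₀ := by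
  intro n M _ _ _ _ _ _ _ _ g _ V K hg hV hRic η C hηs hηc hη01 hηmono hη1 hLη T O ρ hT hO hTO hρ
    heq hint G₀ hG₀ s hs x
  -- the subsolution `z = e^{2Ks} |∇ρ|² − G₀`
  set z : ℝ → M → ℝ := fun r y ↦ Real.exp (2 * K * r) * g.gradSq (ρ r) y + (-G₀) with hz
  have hρs : ∀ r ∈ O, ContMDiff (𝓡 n) 𝓘(ℝ, ℝ) ∞ (ρ r) := fun r hr ↦
    contMDiff_slice_of_contMDiffOn hρ hr
  have hG₀0 : 0 ≤ G₀ := (g.gradSq_nonneg hg _ x).trans (hG₀ x)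
  -- smoothness of `z` on `M × O`
  have hgradfam := contMDiffOn_gradSq_family g hO.uniqueDiffOn hρ
  have hexpfam : ContMDiff ((𝓡 n).prod 𝓘(ℝ, ℝ)) 𝓘(ℝ, ℝ) ∞
      (fun p : M × ℝ ↦ Real.exp (2 * K * p.2)) :=
    (Real.contDiff_exp.comp (contDiff_const.mul contDiff_id)).comp_contMDiff contMDiff_snd
  have hzs : ContMDiffOn ((𝓡 n).prod 𝓘(ℝ, ℝ)) 𝓘(ℝ, ℝ) ∞ (fun p : M × ℝ ↦ z p.2 p.1) (univ ×ˢ O) :=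
    (hexpfam.contMDiffOn.mul hgradfam).add contMDiffOn_const
  -- the subsolution property
  have hsub : ∀ r ∈ Icc 0 T, ∀ y, deriv (fun r' ↦ z r' y) r ≤ g.dalembertian (z r) y -
      g.innerDual y (mvfderiv (𝓡 n) V y).toLinearMap (mvfderiv (𝓡 n) (z r) y).toLinearMap := by
    intro r hr y
    have hrO := hTO hr
    have hgd : HasDerivAt (fun r' ↦ g.gradSq (ρ r') y) (deriv (fun r' ↦ g.gradSq (ρ r') y) r)
        r := by
      have h := hasDerivWithinAt_time_of_contMDiffOn (I := 𝓡 n) (k := ∞) (by simp)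
        (u := fun r' y ↦ g.gradSq (ρ r') y) hgradfam y hrO
      exact (h.hasDerivAt (hO.mem_nhds hrO)).differentiableAt.hasDerivAt
    have hformula := deriv_gradSq_of_heatFlow_isOpen (g := g) hV hO hρ hrO (heq r hr) y
    have hbochner := weightedBochner_pointwise_ge g hg hV hRic (hρs r hrO) y
    have hzd : HasDerivAt (fun r' ↦ z r' y) (Real.exp (2 * K * r) * (2 * K) * g.gradSq (ρ r) y +
        Real.exp (2 * K * r) * deriv (fun r' ↦ g.gradSq (ρ r') y) r) r := by
      have h1 : HasDerivAt (fun r' : ℝ ↦ Real.exp (2 * K * r')) (Real.exp (2 * K * r) * (2 * K))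
          r := by
        have := ((hasDerivAt_id r).const_mul (2 * K)).exp
        simpa using this
      exact (h1.mul hgd).add_const (-G₀)
    rw [hzd.deriv]
    have h2 : ContMDiffAt (𝓡 n) 𝓘(ℝ, ℝ) 2 (g.gradSq (ρ r)) y :=
      ((contMDiff_gradSq g (hρs r hrO)).of_le (WithTop.coe_le_coe.mpr le_top)).contMDiffAt
    have hLz := weightedLaplacian_affine (g := g) (V := V) h2 (Real.exp (2 * K * r)) (-G₀)
    rw [show z r = fun y' ↦ Real.exp (2 * K * r) * g.gradSq (ρ r) y' + (-G₀) from rfl, hLz,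
      hformula]
    have hE := Real.exp_pos (2 * K * r)
    nlinarith [hbochner, hE]
  have hz0 : ∀ y, z 0 y ≤ 0 := by
    intro y
    simp only [hz, mul_zero, Real.exp_zero, one_mul]
    linarith [hG₀ y]
  -- `z₊ e^{-V}` is integrable on the strip
  have hexpc : Continuous fun y ↦ Real.exp (-V y) := Real.continuous_exp.comp hV.continuous.neg
  have hint' : Integrable (fun p : M × ℝ ↦ max (z p.2 p.1) 0 * Real.exp (-V p.1))
      ((g.riemVolume.prod (volume : Measure ℝ)).restrict (univ ×ˢ Ioo 0 T)) := by
    refine (hint.const_mul (Real.exp (2 * |K| * T))).mono' ?_ ?_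
    · have hcont : ContinuousOn (fun p : M × ℝ ↦ max (z p.2 p.1) 0 * Real.exp (-V p.1))
          (univ ×ˢ O) :=
        (hzs.continuousOn.sup continuousOn_const).mul (hexpc.comp continuous_fst).continuousOn
      exact (hcont.mono (prod_mono le_rfl (Ioo_subset_Icc_self.trans hTO))).aestronglyMeasurable
        (MeasurableSet.univ.prod measurableSet_Ioo)
    · refine ae_restrict_of_forall_mem (MeasurableSet.univ.prod measurableSet_Ioo) fun p hp ↦ ?_
      have hs' : p.2 ∈ Ioo 0 T := hp.2
      have hΓ := g.gradSq_nonneg hg (ρ p.2) p.1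
      have hex := Real.exp_pos (-V p.1)
      have hE := Real.exp_pos (2 * K * p.2)
      have hEle : Real.exp (2 * K * p.2) ≤ Real.exp (2 * |K| * T) := by
        refine Real.exp_le_exp.2 ?_
        have h1 : 2 * K * p.2 ≤ 2 * |K| * p.2 := by nlinarith [le_abs_self K, hs'.1]
        have h2 : 2 * |K| * p.2 ≤ 2 * |K| * T := by nlinarith [abs_nonneg K, hs'.2]
        linarith
      have hmax : max (z p.2 p.1) 0 ≤ Real.exp (2 * K * p.2) * g.gradSq (ρ p.2) p.1 :=
        max_le (by simp only [hz]; linarith) (mul_nonneg hE.le hΓ)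
      rw [Real.norm_eq_abs, abs_of_nonneg (mul_nonneg (le_max_right _ _) hex.le)]
      calc max (z p.2 p.1) 0 * Real.exp (-V p.1)
          ≤ (Real.exp (2 * K * p.2) * g.gradSq (ρ p.2) p.1) * Real.exp (-V p.1) :=
            mul_le_mul_of_nonneg_right hmax hex.le
        _ ≤ (Real.exp (2 * |K| * T) * g.gradSq (ρ p.2) p.1) * Real.exp (-V p.1) :=
            mul_le_mul_of_nonneg_right (mul_le_mul_of_nonneg_right hEle hΓ) hex.le
        _ = Real.exp (2 * |K| * T) * (g.gradSq (ρ p.2) p.1 * Real.exp (-V p.1)) := by ring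
  -- the weak maximum principle
  have hmax := helper_weightedMaxPrinciple n M g V hg hV η C hηs hηc hη01 hηmono hη1 hLη T O z hT hO
    hTO hzs hsub hz0 hint' s hs x
  have hle : Real.exp (2 * K * s) * g.gradSq (ρ s) x ≤ G₀ := by
    simp only [hz] at hmax
    linarith
  have hexp : Real.exp (-2 * K * s) * Real.exp (2 * K * s) = 1 := by
    rw [← Real.exp_add]; convert Real.exp_zero using 2; ring
  calc g.gradSq (ρ s) x = Real.exp (-2 * K * s) * (Real.exp (2 * K * s) * g.gradSq (ρ s) x) := by
        rw [← mul_assoc, hexp, one_mul]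
    _ ≤ Real.exp (-2 * K * s) * G₀ := mul_le_mul_of_nonneg_left hle (Real.exp_pos _).le

end Summit.SmoothPoincare4.SmoothPoincare4.Theorems.NoncompactShrinkerGapHeat

end
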